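import Literature.NumberTheory.EllipticCurves.MazurTorsion
import Literature.NumberTheory.EllipticCurves.WeilPairingProofs
import HarnessLib

/-!
# Rational full `m`-torsion forces `μ_m ⊂ K` (Silverman, *AEC* Cor. III.8.1.1): the discharge

Topic `NumberTheory/EllipticCurves`; a theorems-only assembly file (no definitions, no new named
facts). The named fact `WeierstrassCurve.exists_isPrimitiveRoot_of_card_torsionBy_eq_sq W m` of
`MazurTorsion` (Silverman, *The Arithmetic of Elliptic Curves*, Cor. III.8.1.1, the "in particular"
clause: for an elliptic curve `E` over a perfect field `K` and `m ≥ 2` invertible in `K`, if the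
`K`-rational `m`-torsion has `m²` elements then `K` contains a primitive `m`-th root of unity) was
reduced IN THE TREE (`exists_isPrimitiveRoot_of_card_torsionBy_eq_sq_of_exists_weilPairing`, same
file — the printed two-line proof from the Galois equivariance and the surjectivity onto `μ_m` of
the Weil pairing) to the named fact `WeierstrassCurve.exists_weilPairing W m` (*AEC* Prop. III.8.1
(a)–(d)), which has SINCE been proved (`WeierstrassCurve.exists_weilPairing_holds`,
`WeilPairingProofs`). This file feeds the one to the other.

* `WeierstrassCurve.exists_isPrimitiveRoot_of_card_torsionBy_eq_sq_holds W m` — the closed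
  discharge; binders = the fact's own (`[DecidableEq F]`, `W`, `m`).

## References

* J. H. Silverman, *The Arithmetic of Elliptic Curves*, 2nd ed., GTM 106 (2009), Prop. III.8.1,
  Cor. III.8.1.1. [`SilvermanAEC2009`]
-/

noncomputable section

namespace WeierstrassCurve

universe u

variable {F : Type u} [Field F]

/-- **Silverman, *AEC* Cor. III.8.1.1: rational full `m`-torsion forces `μ_m ⊂ K`.** Discharge of
the named fact `WeierstrassCurve.exists_isPrimitiveRoot_of_card_torsionBy_eq_sq W m` of
`MazurTorsion`: for a Weierstrass model `W` over a field `F`, whenever `F` is perfect, `W` is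
elliptic, `2 ≤ m`, `(m : F) ≠ 0` and `E(F)[m]` has `m²` elements, `F` contains a primitive `m`-th
root of unity. Proof: the tree's reduction to the Weil pairing
(`exists_isPrimitiveRoot_of_card_torsionBy_eq_sq_of_exists_weilPairing`, the printed proof) fed with
the tree's construction of the Weil pairing (`exists_weilPairing_holds`, *AEC* Prop. III.8.1).
[cite: SilvermanAEC2009, Cor. III.8.1.1] -/
theorem exists_isPrimitiveRoot_of_card_torsionBy_eq_sq_holds [DecidableEq F] (W : WeierstrassCurve F)
    (m : ℕ) : W.exists_isPrimitiveRoot_of_card_torsionBy_eq_sq m :=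
  W.exists_isPrimitiveRoot_of_card_torsionBy_eq_sq_of_exists_weilPairing m
    (W.exists_weilPairing_holds m)

end WeierstrassCurve

end
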